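import Literature.NumberTheory.Automorphic.Liu2021.Def411WeilCarriersDoubling
import Literature.NumberTheory.GelbartRogawski1991.DoubledWeilRepresentationUniqueness
import HarnessLib

/-!
# The doubled Weil representation and the compatible splitting attached to `χ` are CANONICAL

Topic `NumberTheory/Automorphic/Liu2021`; namespace `Literature.NumberTheory.Automorphic.Liu2021.Def411WeilCarriersDoubling`.
KERNEL only: three theorems, no definition, no named fact, no `sorry`.

`Def411WeilCarriersDoubling.doubledWeilRep χ` is `Classical.choose` of `exists_isDoubledWeilRep` — A witness of
[GelbartRogawski1991, §3.1 Prop. 3.1.1]'s existence statement — and `chiSplitting χ = undoubleHom (doubledWeilRep χ) _` is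
[HarrisKudlaSweet1996]'s `ι̃_{V,χ}` ∕ [Liu2021, App. D Step 2]'s `ι_μ`.  By the uniqueness theorem
`GRConstruction.DoubledWeilUniqueness.isDoubledWeilRep_unique` (a `χ`-normalised doubled Weil representation is unique:
all places + the restricted-product assembly, in kernel) the choice is no choice:

* `doubledWeilRep_eq_of_isDoubledWeilRep` — every `sD` with `IsDoubledWeilRep χ sD` EQUALS `doubledWeilRep χ`;
* `chiSplitting_eq_undoubleHom` — `chiSplitting χ = undoubleHom sD _` for every such `sD`;
* `chiSplittingLine_eq_splittingCongr_undoubleHom` — the same at the hermitian LINE `⟨T_W⟩` (`chiSplittingLine χ … T_W …`,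
  the shape a consumer's splitting binder `s` is fed; at `χ := μ` [Liu2021]'s `ι_μ` for `(V, W₁)`).

So any consumer handed SOME `χ`-normalised doubled Weil representation (e.g. one built place by place with other Haar
data, or the one of a future explicit construction) reads the SAME `chiSplitting χ` ∕ `chiSplittingLine χ`; the μ-link
«`s|_{U(V)×1} = ι_μ`» of the carriers plan is an identification, not a hypothesis.

References: S. Gelbart, J. Rogawski, Invent. Math. 105 (1991), §3.1 Prop. 3.1.1 [GelbartRogawski1991]; S. Kudla, *Notes on the local theta correspondence* (1996), Chap. I §6 Lemma 6.3 [Kudla1996]; S. Kudla, Israel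
J. Math. 87 (1994), §3 Thm. 3.1 [Kudla1994]; M. Harris, S. Kudla, W. J. Sweet, J. Amer. Math. Soc. 9 (1996), §1
(1.14)–(1.15), Cor. A.3 [HarrisKudlaSweet1996]; Y. Liu, Camb. J. Math. 9 (2021), App. D §D.1 Step 2 [Liu2021].

Provenance: pub-hodgecm2 cell (COR-CM, Hodge ladder stage 2), seat s2crux-idea-2 (DIRECT-CONSTRUCTION lens, finding #4).
HC_CM is NOT proved here or anywhere in the tree.  Filed for the tree by the seat `pub-hodgecm-mc-theta-3` at the
lead-acknowledged path `Liu2021/Def411WeilCarriersDoublingUnique.lean` from the author's packet rev 3 (5a84bbaf32c9);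
filer's delta = the third (line-level) corollary.
-/

set_option autoImplicit false

noncomputable section

open scoped Classical
open scoped Matrix Kronecker TensorProduct
open NumberField IsDedekindDomain
open Literature.RepresentationTheory.HeisenbergGroup
open Literature.NumberTheory.Weil1964
open Literature.RepresentationTheory.HarrisKudlaSweet1996
open Literature.NumberTheory.Automorphic
open Literature.NumberTheory.GaloisRepresentations

namespace Literature.NumberTheory.Automorphic.Liu2021.Def411WeilCarriersDoubling

open Literature.NumberTheory.GelbartRogawski1991 Literature.NumberTheory.GelbartRogawski1991.UnitaryDualPair
open Literature.NumberTheory.GelbartRogawski1991.GRConstruction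

variable (L : Type) [Field L] [NumberField L] [IsCMField L]

variable {N M n : ℕ} (e : Fin N × Fin M ≃ Fin n)
  (dV : Fin N → L) (hdV : ∀ i, IsCMField.complexConj L (dV i) = dV i) (hdV0 : ∀ i, dV i ≠ 0)
  (dW : Fin M → L) (hdW : ∀ i, IsCMField.complexConj L (dW i) = dW i) (hdW0 : ∀ i, dW i ≠ 0)

/-- **`doubledWeilRep χ` is THE `χ`-normalised doubled Weil representation**: every `sD : H(𝔸) →* Mp(𝕎^𝔻)` with
`IsDoubledWeilRep χ sD` equals it. [cite: GelbartRogawski1991, §3.1 Prop. 3.1.1 p. 455 L1–2] [cite: Kudla1996, Chap. I §6 Lemma 6.3 (castle.pdf pp. 16–18)] [cite: Kudla1994, §3 Thm. 3.1] -/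
theorem doubledWeilRep_eq_of_isDoubledWeilRep (χ : HeckeCharacter L) (hχu : χ.IsUnitary) (hχs : IsSplittingChar L 1 χ)
    {sD : HA L e dV hdV dW hdW →* MpD L e dV hdV dW hdW} (h : IsDoubledWeilRep L e dV hdV hdV0 dW hdW hdW0 χ sD) :
    doubledWeilRep L e dV hdV hdV0 dW hdW hdW0 χ hχu hχs = sD :=
  DoubledWeilUniqueness.isDoubledWeilRep_unique L e dV hdV hdV0 dW hdW hdW0 χ
    (isDoubledWeilRep_doubledWeilRep L e dV hdV hdV0 dW hdW hdW0 χ hχu hχs) h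

/-- **`chiSplitting χ` does not depend on the choice**: `s_χ = undoubleHom sD` for every `χ`-normalised doubled Weil
representation `sD`. [cite: GelbartRogawski1991, §3.2 p. 457] [cite: Kudla1996, Chap. I §6 Lemma 6.3 (castle.pdf pp. 16–18)] [cite: HarrisKudlaSweet1996, §1 (1.14)–(1.15), Cor. A.3 p. 998] -/
theorem chiSplitting_eq_undoubleHom (χ : HeckeCharacter L) (hχu : χ.IsUnitary) (hχs : IsSplittingChar L 1 χ)
    {sD : HA L e dV hdV dW hdW →* MpD L e dV hdV dW hdW} (h : IsDoubledWeilRep L e dV hdV hdV0 dW hdW hdW0 χ sD) :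
    chiSplitting L e dV hdV hdV0 dW hdW hdW0 χ hχu hχs = undoubleHom L e dV hdV hdV0 dW hdW hdW0 sD h.proj_eq :=
  DoubledWeilUniqueness.undoubleHom_unique L e dV hdV hdV0 dW hdW hdW0 χ
    (isDoubledWeilRep_doubledWeilRep L e dV hdV hdV0 dW hdW hdW0 χ hχu hχs) h

variable {N' n' : ℕ} (e₁ : Fin N' × Fin 1 ≃ Fin n')
  (dV₁ : Fin N' → L) (hdV₁ : ∀ i, IsCMField.complexConj L (dV₁ i) = dV₁ i) (hdV₁0 : ∀ i, dV₁ i ≠ 0)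

set_option maxHeartbeats 2000000 in
-- (one pass through the `splittingDatum` telescope, as in `Def411WeilCarriersDoubling` §4)
/-- **`chiSplittingLine χ …` does not depend on the choice either**: at the hermitian line `⟨T_W⟩` the splitting
attached to `χ` is the transported undoubling of ANY `χ`-normalised doubled Weil representation of the line datum
(at `χ := μ`: [Liu2021]'s `ι_μ` for `(V, W₁)`). [cite: Liu2021, App. D §D.1 Step 2 (l. 5219)] [cite: HarrisKudlaSweet1996, §1 (1.14)–(1.15), Cor. A.3 p. 998] [cite: GelbartRogawski1991, §3.1 Prop. 3.1.1 p. 455 L1–2] -/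
theorem chiSplittingLine_eq_splittingCongr_undoubleHom (χ : HeckeCharacter L) (hχu : χ.IsUnitary)
    (hχs : IsSplittingChar L 1 χ) (TW : Matrix (Fin 1) (Fin 1) (Fp L)) (hWd : IsUnit TW.det)
    (JW : Matrix (Fin 1) (Fin 1) L) (hJW : JW = TW.map (algebraMap (Fp L) L))
    {sD : HA L e₁ dV₁ hdV₁ (lineW L TW) (complexConj_lineW L TW) →*
      MpD L e₁ dV₁ hdV₁ (lineW L TW) (complexConj_lineW L TW)}
    (h : IsDoubledWeilRep L e₁ dV₁ hdV₁ hdV₁0 (lineW L TW) (complexConj_lineW L TW) (lineW_ne_zero L TW hWd) χ sD) :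
    chiSplittingLine L e₁ dV₁ hdV₁ hdV₁0 χ hχu hχs TW hWd JW hJW =
      splittingCongr (Fp L) L (IsCMField.complexConj L) N' 1 e₁ (Matrix.diagonal dV₁) (realDiagonal_lineW L TW)
        (diagonal_lineW L TW hJW)
        (undoubleHom L e₁ dV₁ hdV₁ hdV₁0 (lineW L TW) (complexConj_lineW L TW) (lineW_ne_zero L TW hWd) sD
          h.proj_eq) :=
  congrArg (splittingCongr (Fp L) L (IsCMField.complexConj L) N' 1 e₁ (Matrix.diagonal dV₁) (realDiagonal_lineW L TW)
    (diagonal_lineW L TW hJW))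
    (chiSplitting_eq_undoubleHom L e₁ dV₁ hdV₁ hdV₁0 (lineW L TW) (complexConj_lineW L TW) (lineW_ne_zero L TW hWd)
      χ hχu hχs h)


end Literature.NumberTheory.Automorphic.Liu2021.Def411WeilCarriersDoubling
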